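import Mathlib
import Literature.Probability.RandomGraphs.LowDegree
import Literature.NumberTheory.QuadraticFields.ThreeTorsionMeanSquarefreeEuler

/-!
# Sieve–Walsh lemmas I: Walsh cancellation on progressions across a digit gap

Helper file for the stub `stub_sieveWalsh` of the crux `ArithStatLadder.AcZeroRung`
(stmt-QuantumAdvantage-2425), line `dyadic-chirp-poisson`.

RUNNING LOG (worker): digit/Walsh half of the proof, complete.  Contents:
* `sieve_sum_Ico_mul_blocks`, `sieve_sum_Ico_pow_blocks` — block decomposition of the dyadic
  interval `[2^(n-1), 2^n)` into aligned blocks of length `2^j`;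
* `sieve_walsh_eq_of_le` — Walsh factors on positions `≥ j` only see `d / 2^j`;
* `sieveWalsh_digit_flip` (anchor, registered) and `sieve_walsh_antiperiodic` — ANTIPERIODICITY:
  if `j = max T`, adding `m·2^j` (`m` odd) flips the sign of the Walsh character on `T`;
* `sieve_sum_Ico_antiperiodic`, `sieve_abs_sum_Ico_antiperiodic` — sums of an antiperiodic
  function supported on a residue class over an interval;
* `sieve_walsh_progression_low` — the per-progression bound when the largest digit gap sits
  above an element of `T` (low factor antiperiodic, high factor constant on blocks);
* `sieve_exists_digit_gap` — the pigeonhole producing the largest digit gap `G·(|S|+1) ≥ n − 4`.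
The high case and the assembly are in `ArithStatLadderAcZeroRungSieveWalsh.lean`; the arithmetic
(squarefree sieve, CRT, counts, numerics) in `ArithStatLadderAcZeroRungSieveWalshLemmas2.lean`.
-/

set_option linter.dupNamespace false -- D-0017: single-problem summit ⇒ QuantumAdvantage.QuantumAdvantage by design

noncomputable section

namespace Summit.QuantumAdvantage.QuantumAdvantage.Theorems.AcZeroRung

open Finset
open Literature.Probability.RandomGraphs.LowDegree

/-! ### Walsh characters of the binary digits -/

/-- `|∏ sgn| = 1`. -/
theorem sieve_abs_prod_sgn (T : Finset ℕ) (f : ℕ → Bool) : |∏ i ∈ T, sgn (f i)| = 1 := by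
  rw [Finset.abs_prod]
  refine Finset.prod_eq_one fun i _ => ?_
  cases f i <;> simp [sgn]

/-- `|walsh T x| = 1` for digit positions `T ⊆ ℕ`. -/
theorem sieve_abs_walsh (T : Finset ℕ) (x : ℕ → Bool) : |walsh T x| = 1 :=
  sieve_abs_prod_sgn T x

/-! ### Block decompositions of intervals -/

/-- `Σ_{d ∈ [aL, bL)} F d = Σ_{x ∈ [a, b)} Σ_{d ∈ [xL, (x+1)L)} F d`. -/
theorem sieve_sum_Ico_mul_blocks (F : ℕ → ℝ) (L a b : ℕ) (hab : a ≤ b) :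
    ∑ d ∈ Ico (a * L) (b * L), F d = ∑ x ∈ Ico a b, ∑ d ∈ Ico (x * L) ((x + 1) * L), F d := by
  induction b, hab using Nat.le_induction with
  | base => simp
  | succ b hb ih =>
    rw [Finset.sum_Ico_succ_top hb, ← ih, Finset.sum_Ico_consecutive]
    · exact Nat.mul_le_mul_right L hb
    · exact Nat.mul_le_mul_right L (Nat.le_succ b)

/-- The dyadic block `[2^(n-1), 2^n)` as `2^(n-1-j)` aligned blocks of length `2^j` (`j < n`). -/
theorem sieve_sum_Ico_pow_blocks (F : ℕ → ℝ) {n j : ℕ} (hj : j < n) :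
    ∑ d ∈ Ico (2 ^ (n - 1)) (2 ^ n), F d =
      ∑ x ∈ Ico (2 ^ (n - 1 - j)) (2 ^ (n - j)), ∑ d ∈ Ico (x * 2 ^ j) ((x + 1) * 2 ^ j), F d := by
  have h1 : 2 ^ (n - 1) = 2 ^ (n - 1 - j) * 2 ^ j := by rw [← pow_add]; congr 1; omega
  have h2 : 2 ^ n = 2 ^ (n - j) * 2 ^ j := by rw [← pow_add]; congr 1; omega
  rw [h1, h2]
  exact sieve_sum_Ico_mul_blocks F _ _ _ (Nat.pow_le_pow_right two_pos (by omega))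

/-- The number of aligned blocks: `2^(n-j) - 2^(n-1-j) = 2^(n-1-j)` (`j < n`). -/
theorem sieve_card_Ico_pow (n j : ℕ) (hj : j < n) :
    (Ico (2 ^ (n - 1 - j)) (2 ^ (n - j))).card = 2 ^ (n - 1 - j) := by
  rw [Nat.card_Ico]
  have : 2 ^ (n - j) = 2 * 2 ^ (n - 1 - j) := by rw [← pow_succ']; congr 1; omega
  omega

/-- Walsh factors on positions `≥ j` depend on `d / 2^j` only. -/
theorem sieve_walsh_eq_of_le (T : Finset ℕ) {j : ℕ} (hT : ∀ i ∈ T, j ≤ i) (d : ℕ) :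
    walsh T (Nat.testBit d) = ∏ i ∈ T, sgn (Nat.testBit (d / 2 ^ j) (i - j)) := by
  unfold walsh
  refine Finset.prod_congr rfl fun i hi => ?_
  rw [Nat.testBit_div_two_pow, Nat.sub_add_cancel (hT i hi)]

/-- Digits below `j` are unchanged by adding a multiple of `2^j`. -/
theorem sieve_testBit_add_of_lt {i j : ℕ} (hij : i < j) (d m : ℕ) :
    Nat.testBit (d + m * 2 ^ j) i = Nat.testBit d i := by
  have h1 : ∀ x, Nat.testBit x i = Nat.testBit (x % 2 ^ j) i := fun x => by
    rw [Nat.testBit_mod_two_pow]; simp [hij]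
  rw [h1, Nat.add_mul_mod_self_right, ← h1]

/-- DIGIT FLIP (anchor lemma of this helper file): digit `j` flips when adding an odd multiple
of `2^j`. -/
theorem sieveWalsh_digit_flip :
    ∀ (j d m : ℕ), Odd m → Nat.testBit (d + m * 2 ^ j) j = !Nat.testBit d j := by
  intro j d m hm
  rw [show d + m * 2 ^ j = 2 ^ j * m + d by ring, Nat.testBit_mul_two_pow_add_eq,
    Nat.odd_iff.mp hm]
  simp

/-- ANTIPERIODICITY: if `j ∈ T` is the largest position of `T` and `m` is odd, then
`walsh T (bits (d + m·2^j)) = - walsh T (bits d)`. -/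
theorem sieve_walsh_antiperiodic (T : Finset ℕ) {j : ℕ} (hj : j ∈ T)
    (hT : ∀ i ∈ T, i ≤ j) {m : ℕ} (hm : Odd m) (d : ℕ) :
    walsh T (Nat.testBit (d + m * 2 ^ j)) = - walsh T (Nat.testBit d) := by
  classical
  unfold walsh
  rw [← Finset.mul_prod_erase T _ hj,
    ← Finset.mul_prod_erase T (fun i => sgn (Nat.testBit d i)) hj,
    sieveWalsh_digit_flip j d m hm]
  have h : ∏ i ∈ T.erase j, sgn (Nat.testBit (d + m * 2 ^ j) i) =
      ∏ i ∈ T.erase j, sgn (Nat.testBit d i) := by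
    refine Finset.prod_congr rfl fun i hi => ?_
    have hij : i < j :=
      lt_of_le_of_ne (hT i (Finset.mem_of_mem_erase hi)) (Finset.ne_of_mem_erase hi)
    rw [sieve_testBit_add_of_lt hij]
  rw [h]
  cases Nat.testBit d j <;> simp [sgn]

/-! ### Antiperiodic functions on intervals -/

/-- An antiperiodic function sums to zero over whole double antiperiods. -/
theorem sieve_sum_Ico_antiperiodic {g : ℕ → ℝ} {H : ℕ} (hg : ∀ d, g (d + H) = - g d)
    (a k : ℕ) : ∑ d ∈ Ico a (a + k * (2 * H)), g d = 0 := by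
  induction k with
  | zero => simp
  | succ k ih =>
    rw [← Finset.sum_Ico_consecutive g (Nat.le_add_right a (k * (2 * H)))
      (by nlinarith), ih, zero_add]
    have hb : a + (k + 1) * (2 * H) = a + k * (2 * H) + H + H := by ring
    rw [hb, ← Finset.sum_Ico_consecutive g (Nat.le_add_right (a + k * (2 * H)) H)
      (Nat.le_add_right _ H), ← Finset.sum_Ico_add' g (a + k * (2 * H)) (a + k * (2 * H) + H) H,
      ← Finset.sum_add_distrib]
    refine Finset.sum_eq_zero fun d _ => ?_
    rw [hg]; ring

/-- Counting a residue class in an interval of naturals: `|#{x ∈ [a, a+L) : x ≡ v (P)} − L/P| ≤ 1`. -/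
theorem sieve_abs_card_modEq_sub_le (a L : ℕ) {P : ℕ} (hP : 0 < P) (v : ℕ) :
    |((((Ico a (a + L)).filter (· ≡ v [MOD P])).card : ℕ) : ℝ) - (L : ℝ) / P| ≤ 1 := by
  have h := Literature.NumberTheory.QuadraticFields.abs_card_Ico_filter_modEq_sub_le
    (a := (a : ℤ)) (b := ((a + L : ℕ) : ℤ)) (by push_cast; linarith) (r := (P : ℤ))
    (by exact_mod_cast hP) (v : ℤ)
  rw [← Nat.Ico_filter_modEq_cast, Finset.card_map] at h
  push_cast at h
  rw [show ((a : ℝ) + L - a) = L by ring] at h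
  exact h

/-- For `g` antiperiodic (antiperiod `H`), supported on a residue class mod `P > 0` and bounded
by `1`: the sum of `g` over any interval `[a, a + L)` is at most `2H/P + 1` in absolute value. -/
theorem sieve_abs_sum_Ico_antiperiodic {g : ℕ → ℝ} {H P c : ℕ} (hH : 0 < H) (hP : 0 < P)
    (hg : ∀ d, g (d + H) = - g d) (hgc : ∀ d, ¬ d ≡ c [MOD P] → g d = 0)
    (hg1 : ∀ d, |g d| ≤ 1) (a L : ℕ) :
    |∑ d ∈ Ico a (a + L), g d| ≤ 2 * (H : ℝ) / P + 1 := by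
  obtain ⟨k, R, hRlt, hL⟩ : ∃ k R, R < 2 * H ∧ L = k * (2 * H) + R :=
    ⟨L / (2 * H), L % (2 * H), Nat.mod_lt L (by omega), (Nat.div_add_mod' L (2 * H)).symm⟩
  rw [hL, ← add_assoc,
    ← Finset.sum_Ico_consecutive g (Nat.le_add_right a _) (Nat.le_add_right _ R),
    sieve_sum_Ico_antiperiodic hg a k, zero_add]
  set b := a + k * (2 * H) with hb
  have hfilter : ∑ d ∈ Ico b (b + R), g d = ∑ d ∈ (Ico b (b + R)).filter (· ≡ c [MOD P]), g d := by
    rw [Finset.sum_filter]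
    refine Finset.sum_congr rfl fun d _ => ?_
    by_cases h : d ≡ c [MOD P]
    · rw [if_pos h]
    · rw [if_neg h, hgc d h]
  rw [hfilter]
  calc |∑ d ∈ (Ico b (b + R)).filter (· ≡ c [MOD P]), g d|
      ≤ ∑ d ∈ (Ico b (b + R)).filter (· ≡ c [MOD P]), |g d| := Finset.abs_sum_le_sum_abs _ _
    _ ≤ ∑ d ∈ (Ico b (b + R)).filter (· ≡ c [MOD P]), (1 : ℝ) :=
        Finset.sum_le_sum fun d _ => hg1 d
    _ = ((((Ico b (b + R)).filter (· ≡ c [MOD P])).card : ℕ) : ℝ) := by simp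
    _ ≤ (R : ℝ) / P + 1 := by
        have := (abs_le.mp (sieve_abs_card_modEq_sub_le b R hP c)).2
        linarith
    _ ≤ 2 * (H : ℝ) / P + 1 := by
        gcongr
        exact_mod_cast hRlt.le

/-! ### Per-progression Walsh bounds -/

/-- LOW CASE (the largest gap sits between `j₁ ∈ T` and `j₂`, no position of `T` strictly in
between, `4 ≤ j₁`): on a progression `d ≡ c (mod 16m)`, `m` odd, inside `[2^(n-1), 2^n)`,
`|Σ walsh_T| ≤ 2^(n-1-j₂)·(2^(j₁-3) + 1)` — the low factor is antiperiodic under `d ↦ d + m2^{j₁}`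
(a multiple of the modulus) and the high factor is constant on aligned `2^{j₂}`-blocks. -/
theorem sieve_walsh_progression_low (T : Finset ℕ) {n j₁ j₂ m : ℕ} (c : ℕ) (h4 : 4 ≤ j₁)
    (h2n : j₂ < n) (hj₁ : j₁ ∈ T) (hT : ∀ i ∈ T, i ≤ j₁ ∨ j₂ ≤ i) (hm : Odd m) :
    |∑ d ∈ (Ico (2 ^ (n - 1)) (2 ^ n)).filter (· ≡ c [MOD 16 * m]), walsh T (Nat.testBit d)|
      ≤ (2 : ℝ) ^ (n - 1 - j₂) * ((2 : ℝ) ^ (j₁ - 3) + 1) := by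
  classical
  set Tlo := T.filter (fun i => i ≤ j₁) with hTlo
  set Thi := T.filter (fun i => ¬ i ≤ j₁) with hThi
  have hThi' : ∀ i ∈ Thi, j₂ ≤ i := by
    intro i hi
    rw [hThi, Finset.mem_filter] at hi
    exact (hT i hi.1).resolve_left hi.2
  have hsplit : ∀ x : ℕ → Bool, walsh T x = walsh Tlo x * walsh Thi x := fun x =>
    (Finset.prod_filter_mul_prod_filter_not T _ _).symm
  have hm0 : 0 < m := hm.pos
  -- the antiperiodic function
  set g : ℕ → ℝ := fun d => if d ≡ c [MOD 16 * m] then walsh Tlo (Nat.testBit d) else 0 with hg_def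
  have hper : ∀ d, d + m * 2 ^ j₁ ≡ d [MOD 16 * m] := by
    intro d
    have hdvd : 16 * m ∣ m * 2 ^ j₁ := ⟨2 ^ (j₁ - 4), by
      rw [show (2 : ℕ) ^ j₁ = 2 ^ 4 * 2 ^ (j₁ - 4) by rw [← pow_add]; congr 1; omega]; ring⟩
    simpa using (Nat.modEq_zero_iff_dvd.2 hdvd).add_left d
  have hg : ∀ d, g (d + m * 2 ^ j₁) = - g d := by
    intro d
    by_cases hd : d ≡ c [MOD 16 * m]
    · simp only [hg_def, if_pos ((hper d).trans hd), if_pos hd]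
      exact sieve_walsh_antiperiodic Tlo (by rw [hTlo, Finset.mem_filter]; exact ⟨hj₁, le_rfl⟩)
        (fun i hi => (Finset.mem_filter.1 hi).2) hm d
    · have hd' : ¬ (d + m * 2 ^ j₁ ≡ c [MOD 16 * m]) := fun h => hd ((hper d).symm.trans h)
      simp only [hg_def, if_neg hd', if_neg hd, neg_zero]
  have hgc : ∀ d, ¬ d ≡ c [MOD 16 * m] → g d = 0 := fun d hd => by
    simp only [hg_def, if_neg hd]
  have hg1 : ∀ d, |g d| ≤ 1 := fun d => by
    simp only [hg_def]
    split_ifs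
    · exact (sieve_abs_walsh _ _).le
    · simp
  -- block decomposition
  rw [Finset.sum_filter, sieve_sum_Ico_pow_blocks _ h2n]
  have hblock : ∀ x, (∑ d ∈ Ico (x * 2 ^ j₂) ((x + 1) * 2 ^ j₂),
      (if d ≡ c [MOD 16 * m] then walsh T (Nat.testBit d) else 0))
      = walsh Thi (Nat.testBit (x * 2 ^ j₂)) * ∑ d ∈ Ico (x * 2 ^ j₂) (x * 2 ^ j₂ + 2 ^ j₂), g d := by
    intro x
    rw [show (x + 1) * 2 ^ j₂ = x * 2 ^ j₂ + 2 ^ j₂ by ring, Finset.mul_sum]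
    refine Finset.sum_congr rfl fun d hd => ?_
    have hd' := Finset.mem_Ico.1 hd
    have hdx : d / 2 ^ j₂ = x := Nat.div_eq_of_lt_le hd'.1 (by linarith [hd'.2])
    have hhi : walsh Thi (Nat.testBit d) = walsh Thi (Nat.testBit (x * 2 ^ j₂)) := by
      rw [sieve_walsh_eq_of_le Thi hThi', sieve_walsh_eq_of_le Thi hThi', hdx,
        Nat.mul_div_cancel _ (by positivity)]
    simp only [hg_def]
    split_ifs
    · rw [hsplit, hhi, mul_comm]
    · rw [mul_zero]
  simp_rw [hblock]
  have hE : ∀ x, |∑ d ∈ Ico (x * 2 ^ j₂) (x * 2 ^ j₂ + 2 ^ j₂), g d| ≤ (2 : ℝ) ^ (j₁ - 3) + 1 := by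
    intro x
    have h := sieve_abs_sum_Ico_antiperiodic (H := m * 2 ^ j₁) (P := 16 * m) (c := c) (g := g)
      (by positivity) (by omega) hg hgc hg1 (x * 2 ^ j₂) (2 ^ j₂)
    refine h.trans (le_of_eq ?_)
    have h2 : (2 : ℝ) ^ j₁ = 2 ^ (j₁ - 3) * 8 := by
      rw [show (8 : ℝ) = 2 ^ 3 by norm_num, ← pow_add]; congr 1; omega
    have hm' : (m : ℝ) ≠ 0 := by exact_mod_cast hm0.ne'
    push_cast
    rw [h2]
    field_simp
    ring
  calc |∑ x ∈ Ico (2 ^ (n - 1 - j₂)) (2 ^ (n - j₂)),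
        walsh Thi (Nat.testBit (x * 2 ^ j₂)) * ∑ d ∈ Ico (x * 2 ^ j₂) (x * 2 ^ j₂ + 2 ^ j₂), g d|
      ≤ ∑ x ∈ Ico (2 ^ (n - 1 - j₂)) (2 ^ (n - j₂)),
        |walsh Thi (Nat.testBit (x * 2 ^ j₂)) * ∑ d ∈ Ico (x * 2 ^ j₂) (x * 2 ^ j₂ + 2 ^ j₂), g d| :=
        Finset.abs_sum_le_sum_abs _ _
    _ ≤ ∑ x ∈ Ico (2 ^ (n - 1 - j₂)) (2 ^ (n - j₂)), ((2 : ℝ) ^ (j₁ - 3) + 1) := by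
        refine Finset.sum_le_sum fun x _ => ?_
        rw [abs_mul, sieve_abs_walsh, one_mul]
        exact hE x
    _ = (2 : ℝ) ^ (n - 1 - j₂) * ((2 : ℝ) ^ (j₁ - 3) + 1) := by
        rw [Finset.sum_const, sieve_card_Ico_pow n j₂ h2n, nsmul_eq_mul]
        push_cast
        ring

/-! ### The largest digit gap -/

/-- PIGEONHOLE FOR THE LARGEST DIGIT GAP: for a nonempty set `S` of positions in `[4, n-2]` there
are consecutive elements `j₁ < j₂` of `{3} ∪ S ∪ {n-1}` (no element of `S` strictly between) with
`(j₂ - j₁)·(#S + 1) ≥ n - 4`. -/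
theorem sieve_exists_digit_gap (S : Finset ℕ) {n : ℕ} (hS : S.Nonempty)
    (hSn : ∀ i ∈ S, 4 ≤ i ∧ i + 1 < n) :
    ∃ j₁ j₂ : ℕ, j₁ < j₂ ∧ (j₁ = 3 ∨ j₁ ∈ S) ∧ (j₂ = n - 1 ∨ j₂ ∈ S) ∧
      (∀ i ∈ S, i ≤ j₁ ∨ j₂ ≤ i) ∧ n - 4 ≤ (j₂ - j₁) * (S.card + 1) := by
  classical
  obtain ⟨i₀, hi₀⟩ := hS
  have hn : 6 ≤ n := by have := hSn i₀ hi₀; omega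
  -- the next element of `S ∪ {n-1}` after `e`
  let nxt : ℕ → ℕ := fun e =>
    (insert (n - 1) (S.filter (fun x => e < x))).min' (Finset.insert_nonempty _ _)
  have hnxt_mem : ∀ e, nxt e = n - 1 ∨ (nxt e ∈ S ∧ e < nxt e) := by
    intro e
    have := Finset.min'_mem (insert (n - 1) (S.filter (fun x => e < x)))
      (Finset.insert_nonempty _ _)
    rw [Finset.mem_insert, Finset.mem_filter] at this
    exact this
  have hnxt_le : ∀ e, ∀ x ∈ S, e < x → nxt e ≤ x := fun e x hx hex =>
    Finset.min'_le _ _ (by rw [Finset.mem_insert, Finset.mem_filter]; exact Or.inr ⟨hx, hex⟩)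
  have hnxt_gt : ∀ e, e < n - 1 → e < nxt e := by
    intro e he
    rcases hnxt_mem e with h | h
    · omega
    · exact h.2
  set E := insert 3 S with hE_def
  have h3E : 3 ∈ E := Finset.mem_insert_self _ _
  have hSE : ∀ y ∈ S, y ∈ E := fun y hy => Finset.mem_insert_of_mem hy
  have hE : ∀ e ∈ E, e < n - 1 := by
    intro e he
    rw [hE_def, Finset.mem_insert] at he
    rcases he with rfl | he
    · omega
    · have := hSn e he; omega
  obtain ⟨j₁, hj₁E, hmax⟩ :=
    Finset.exists_max_image E (fun e => nxt e - e) ⟨3, h3E⟩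
  refine ⟨j₁, nxt j₁, hnxt_gt j₁ (hE j₁ hj₁E), ?_, ?_, ?_, ?_⟩
  · rw [hE_def, Finset.mem_insert] at hj₁E; exact hj₁E
  · rcases hnxt_mem j₁ with h | h
    · exact Or.inl h
    · exact Or.inr h.1
  · intro i hi
    by_cases h : i ≤ j₁
    · exact Or.inl h
    · exact Or.inr (hnxt_le j₁ i hi (by omega))
  · -- the intervals `[e, nxt e)`, `e ∈ E`, cover `[3, n-1)`
    have hcover : Ico 3 (n - 1) ⊆ E.biUnion (fun e => Ico e (nxt e)) := by
      intro x hx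
      rw [Finset.mem_Ico] at hx
      rw [Finset.mem_biUnion]
      have hne : (E.filter (fun e => e ≤ x)).Nonempty :=
        ⟨3, by rw [Finset.mem_filter]; exact ⟨h3E, hx.1⟩⟩
      have he_mem := Finset.max'_mem _ hne
      rw [Finset.mem_filter] at he_mem
      refine ⟨(E.filter (fun e => e ≤ x)).max' hne, he_mem.1, ?_⟩
      rw [Finset.mem_Ico]
      refine ⟨he_mem.2, ?_⟩
      by_contra hlt
      rw [not_lt] at hlt
      rcases hnxt_mem ((E.filter (fun e => e ≤ x)).max' hne) with h | h
      · omega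
      · have hmem : nxt ((E.filter (fun e => e ≤ x)).max' hne) ∈ E.filter (fun e => e ≤ x) := by
          rw [Finset.mem_filter]
          exact ⟨hSE _ h.1, hlt⟩
        have := Finset.le_max' _ _ hmem
        exact absurd h.2 (not_lt.2 this)
    have hcard := (Finset.card_le_card hcover).trans Finset.card_biUnion_le
    rw [Nat.card_Ico] at hcard
    have hsum : ∑ e ∈ E, (Ico e (nxt e)).card ≤ E.card * (nxt j₁ - j₁) := by
      rw [← smul_eq_mul, ← Finset.sum_const]
      refine Finset.sum_le_sum fun e he => ?_
      rw [Nat.card_Ico]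
      exact hmax e he
    have hEcard : E.card ≤ S.card + 1 := Finset.card_insert_le _ _
    calc n - 4 = n - 1 - 3 := by omega
      _ ≤ E.card * (nxt j₁ - j₁) := hcard.trans hsum
      _ ≤ (S.card + 1) * (nxt j₁ - j₁) := Nat.mul_le_mul_right _ hEcard
      _ = (nxt j₁ - j₁) * (S.card + 1) := mul_comm _ _

end Summit.QuantumAdvantage.QuantumAdvantage.Theorems.AcZeroRung

end
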